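import Summits.RiemannHypothesis.RiemannHypothesis.Theorems.SignConeConeMagnificationStubFakeMertensIntegrated
import Summits.RiemannHypothesis.RiemannHypothesis.Theorems.SignConeConeMagnificationFakeMertensWindow
import Literature.NumberTheory.LFunctions.WeilMarkovQuadratic

/-!
# Stub `stub_fakeMertens` of line `Sketch` for crux `SignCone.ConeMagnification`, part 2: the stub
(item stmt-RiemannHypothesis-16303, route route-RiemannHypothesis-SignCone)

FAKE PNT ⇒ CHEBYSHEV AND MERTENS.  Let `c ≥ 0` satisfy the fake PNT of `stub_fakePNT`: for every Weil test `g`,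
with `K = g ⋆ g̃`, the smoothed fake prime sum `S(x) = Σₙ c(n) n^{-1/2}(K(x + log n) + K(x − log n))` has
`‖S(x) − e^{x/2}K̂(0) − e^{-x/2}K̂(1)‖ ≤ C_g` for all real `x`.  Then

* (i) `Σ_{n ≤ x} c(n) ≤ A·x` for `x ≥ 1` (`chebyshev_linear`, the dyadic argument of `stub_chebyshev`);
* (ii) `Σ_{n ≤ x} c(n)/n − log x` converges (`mertens_limit`).

Proof of (ii).  For `0 < a ≤ 1` take the node-nonnegative bump `φ` supported in `[-a, a]`
(`exists_nodeNonneg_bump`); `K = φ ⋆ φ̃` has `Re K ≥ 0`, vanishes for `|u| ≥ 2a`, and the window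
`w(u) = e^{-u/2} Re K(u)` has mass `κ = ∫ w = Re K̂(0) > 0`.  Part 1 (`stub_fakeMertens_integrated`, p142020)
integrates the discrepancy: the window sums `Φ(y) = Σₙ (c(n)/n) ∫_{2a−log n}^{y−log n} w` satisfy
`|Φ(y) − Φ(y') − (y − y')κ| ≤ E(y') → 0`.  The sandwich `κH(y − 2a) ≤ Φ(y) − F + κH(4a) ≤ κH(y + 2a)`
(`FakeMertens.win_sandwich`) for the sharp harmonic sums `H(z) = Σ_{n ≤ e^z} c(n)/n` then gives
`|(H(z) − z) − (H(z') − z')| ≤ 5a` for all large `z, z'` (`mertens_osc_le`).  As `a > 0` is arbitrary,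
`H(z) − z` is Cauchy, hence convergent, and `x = e^z` finishes.
-/

noncomputable section

-- `Summit.RiemannHypothesis.RiemannHypothesis.…` repeats a namespace component by design (D-0017 layout).
set_option linter.dupNamespace false

open scoped BigOperators ComplexConjugate Topology
open Complex MeasureTheory Set Filter

namespace Summit.RiemannHypothesis.RiemannHypothesis.Theorems.SignConeConeMagnification

open Literature.NumberTheory.LFunctions
open Summit.RiemannHypothesis.RiemannHypothesis.Theorems.SignCone
open FakeMertens

/-! ## (i) Chebyshev -/

/-- **Fake PNT ⇒ `Σ_{n ≤ x} c(n) ≤ A x` (`x ≥ 1`)**, by the dyadic block bound of `stub_chebyshev`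
(`sum_Ioc_half_le_of_discrepancy`, `sum_Ioc_zero_le_of_half`). [folklore] -/
theorem chebyshev_linear (c : ℕ → ℝ) (hc : ∀ n, 0 ≤ c n)
    (hdisc : ∀ g : ℝ → ℂ, IsWeilTest g → ∃ C : ℝ, ∀ x : ℝ,
      ‖(∑' n : ℕ, ((c n : ℝ) : ℂ) / (Real.sqrt n : ℂ) *
          (weilConv g (weilReflect g) (x + Real.log n) + weilConv g (weilReflect g) (x - Real.log n))) -
        Complex.exp (x / 2) * weilMellin (weilConv g (weilReflect g)) 0 -
        Complex.exp (-(x / 2)) * weilMellin (weilConv g (weilReflect g)) 1‖ ≤ C) :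
    ∃ A : ℝ, ∀ x : ℝ, 1 ≤ x → ∑ n ∈ Finset.Icc 1 ⌊x⌋₊, c n ≤ A * x := by
  obtain ⟨φ, hφ, hsupp, hnn, hpos⟩ := exists_nodeNonneg_bump (a := (1 : ℝ)) one_pos
  have hKc : Continuous (weilConv φ (weilReflect φ)) := (hφ.weilConv hφ.weilReflect).1.continuous
  obtain ⟨t₀, ht₀, hmin⟩ := (isCompact_Icc : IsCompact (Icc (-1 : ℝ) 1)).exists_isMinOn
    (nonempty_Icc.2 (by norm_num)) (Complex.continuous_re.comp hKc).continuousOn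
  set m : ℝ := (weilConv φ (weilReflect φ) t₀).re with hm_def
  have hm : 0 < m := hpos t₀ (by rw [mul_one]; exact (abs_le.2 ⟨ht₀.1, ht₀.2⟩).trans_lt one_lt_two)
  have hmK : ∀ t ∈ Icc (-1 : ℝ) 1, m ≤ (weilConv φ (weilReflect φ) t).re := fun t ht =>
    (isMinOn_iff.1 hmin) t ht
  obtain ⟨C, hC⟩ := hdisc φ hφ
  have hC0 : 0 ≤ C := (norm_nonneg _).trans (hC 0)
  set B : ℝ := (C + ‖weilMellin (weilConv φ (weilReflect φ)) 0‖ +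
    ‖weilMellin (weilConv φ (weilReflect φ)) 1‖) / m with hB_def
  have hB : 0 ≤ B := by positivity
  have hblock : ∀ N : ℕ, 1 ≤ N → ∑ n ∈ Finset.Ioc (N / 2) N, c n ≤ B * N := fun N hN =>
    sum_Ioc_half_le_of_discrepancy hc hφ hsupp hnn hm hmK hC hN
  have hall : ∀ N : ℕ, ∑ n ∈ Finset.Ioc 0 N, c n ≤ 2 * B * N := sum_Ioc_zero_le_of_half hB hblock
  refine ⟨2 * B, fun x hx => ?_⟩
  have hIcc : Finset.Icc 1 ⌊x⌋₊ = Finset.Ioc 0 ⌊x⌋₊ := by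
    ext n
    simp only [Finset.mem_Icc, Finset.mem_Ioc]
    omega
  rw [hIcc]
  refine (hall ⌊x⌋₊).trans ?_
  exact mul_le_mul_of_nonneg_left (Nat.floor_le (by linarith)) (by positivity)

/-! ## (ii) Mertens: the oscillation bound at scale `a` -/

/-- **Oscillation of `H(z) − z` at scale `a`.**  Under the fake PNT, for every `0 < a ≤ 1` there is `Z` with
`(H(z) − z) − (H(z') − z') ≤ 5a` for all `z, z' ≥ Z`, where `H(z) = Σ_{1 ≤ n ≤ e^z} c(n)/n`
(window sums of the node-nonnegative bump at scale `a`, part 1, and the sandwich). [folklore] -/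
theorem mertens_osc_le (c : ℕ → ℝ) (hc : ∀ n, 0 ≤ c n)
    (hdisc : ∀ g : ℝ → ℂ, IsWeilTest g → ∃ C : ℝ, ∀ x : ℝ,
      ‖(∑' n : ℕ, ((c n : ℝ) : ℂ) / (Real.sqrt n : ℂ) *
          (weilConv g (weilReflect g) (x + Real.log n) + weilConv g (weilReflect g) (x - Real.log n))) -
        Complex.exp (x / 2) * weilMellin (weilConv g (weilReflect g)) 0 -
        Complex.exp (-(x / 2)) * weilMellin (weilConv g (weilReflect g)) 1‖ ≤ C)
    {a : ℝ} (ha : 0 < a) (ha1 : a ≤ 1) :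
    ∃ Z : ℝ, ∀ z z' : ℝ, Z ≤ z → Z ≤ z' →
      ((∑ n ∈ Finset.Icc 1 ⌊Real.exp z⌋₊, c n / n) - z) -
        ((∑ n ∈ Finset.Icc 1 ⌊Real.exp z'⌋₊, c n / n) - z') ≤ 5 * a := by
  have ha0 : 0 ≤ a := ha.le
  obtain ⟨φ, hφ, hsupp, hnn, hpos⟩ := exists_nodeNonneg_bump ha
  obtain ⟨C, hC⟩ := hdisc φ hφ
  have hC0 : 0 ≤ C := (norm_nonneg _).trans (hC 0)
  -- part 1, for this bump
  have hP1 := stub_fakeMertens_integrated c φ hφ a ha ha1 hsupp C hC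
  set K : ℝ → ℂ := weilConv φ (weilReflect φ) with hK
  have hKW : IsWeilTest K := hφ.weilConv hφ.weilReflect
  have hKc : Continuous K := hKW.1.continuous
  -- the window
  set w : ℝ → ℝ := fun u => Real.exp (-(u / 2)) * (K u).re with hw_def
  have hwc : Continuous w := by
    simp only [hw_def]
    fun_prop
  have hw : ∀ u, 0 ≤ w u := fun u => mul_nonneg (Real.exp_pos _).le (hnn u)
  have hw0 : ∀ u, 2 * a ≤ |u| → w u = 0 := fun u hu => by
    have hKu : K u = 0 := weilConv_weilReflect_eq_zero_of_le_abs hφ hsupp hu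
    simp only [hw_def]
    rw [hKu, Complex.zero_re, mul_zero]
  have hwsupp : Function.support w ⊆ Ioc (-(2 * a)) (2 * a) := by
    intro u hu
    rw [Function.mem_support] at hu
    by_contra hnot
    refine hu (hw0 u ?_)
    simp only [mem_Ioc, not_and_or, not_lt, not_le] at hnot
    rcases hnot with h | h
    · rw [abs_of_nonpos (by linarith)]
      linarith
    · rw [abs_of_pos (by linarith)]
      exact h.le
  have hwcs : HasCompactSupport w := by
    refine HasCompactSupport.intro (isCompact_Icc : IsCompact (Icc (-(2 * a)) (2 * a))) fun u hu => ?_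
    by_contra hne
    exact hu (Ioc_subset_Icc_self (hwsupp (Function.mem_support.2 hne)))
  -- `κ = ∫ w = Re K̂(0) > 0`
  set κ : ℝ := ∫ u in (-(2 * a))..(2 * a), w u with hκ
  have hκ_int : ∫ u, w u = κ := (intervalIntegral.integral_eq_integral_of_support_subset hwsupp).symm
  have hκ_eq : (weilMellin K 0).re = κ := by
    rw [← hκ_int]
    have hint : Integrable (fun t : ℝ => K t * cexp ((0 - 1 / 2) * t)) := by
      refine Continuous.integrable_of_hasCompactSupport (by fun_prop) ?_
      exact hKW.2.mul_right
    have h1 := integral_re hint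
    simp only [RCLike.re_to_complex] at h1
    rw [weilMellin, ← h1]
    refine integral_congr_ae (Eventually.of_forall fun t => ?_)
    simp only [hw_def]
    have he : cexp ((0 - 1 / 2) * (t : ℂ)) = ((Real.exp (-(t / 2)) : ℝ) : ℂ) := by
      rw [Complex.ofReal_exp]
      congr 1
      push_cast
      ring
    rw [he, mul_comm, Complex.re_ofReal_mul]
  have hκ_pos : 0 < κ := by
    rw [← hκ_int]
    refine hwc.integral_pos_of_hasCompactSupport_nonneg_nonzero hwcs (fun u => hw u) (x := 0) ?_
    simp only [hw_def]
    have h0 : 0 < (K 0).re := hpos 0 (by rw [abs_zero]; linarith)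
    positivity
  set κ₁ : ℝ := (weilMellin K 1).re with hκ₁
  -- the error `E(t) = 2C e^{-t/2} + |κ₁| e^{-t}` is eventually `≤ aκ`
  have hE : Tendsto (fun t : ℝ => 2 * C * Real.exp (-(t / 2)) + |κ₁| * Real.exp (-t)) atTop (𝓝 0) := by
    have h1 : Tendsto (fun t : ℝ => Real.exp (-(t / 2))) atTop (𝓝 0) :=
      Real.tendsto_exp_neg_atTop_nhds_zero.comp (tendsto_id.atTop_div_const two_pos)
    have h2 : Tendsto (fun t : ℝ => Real.exp (-t)) atTop (𝓝 0) := Real.tendsto_exp_neg_atTop_nhds_zero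
    simpa using (h1.const_mul (2 * C)).add (h2.const_mul |κ₁|)
  obtain ⟨T, hT⟩ := eventually_atTop.1 (hE.eventually (gt_mem_nhds (mul_pos ha hκ_pos)))
  -- the threshold
  refine ⟨max (T + 2 * a) (8 * a), fun z z' hz hz' => ?_⟩
  have hzT : T + 2 * a ≤ z := (le_max_left _ _).trans hz
  have hz8 : 8 * a ≤ z := (le_max_right _ _).trans hz
  have hz'T : T + 2 * a ≤ z' := (le_max_left _ _).trans hz'
  have hz'8 : 8 * a ≤ z' := (le_max_right _ _).trans hz'
  -- a common truncation `N`
  set N : ℕ := ⌊Real.exp (max z z' + 2 * a + 2)⌋₊ + 1 with hN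
  have hNlt : Real.exp (max z z' + 2 * a + 2) < N := by
    simp only [hN, Nat.cast_add, Nat.cast_one]
    exact Nat.lt_floor_add_one _
  have hNy : ∀ y : ℝ, y ≤ max z z' + 2 * a → Real.exp (y + 2) < N := fun y hy =>
    lt_of_le_of_lt (Real.exp_le_exp.2 (by linarith)) hNlt
  have hNy' : ∀ y : ℝ, y ≤ max z z' + 2 → Real.exp (y + 2 * a) < N := fun y hy =>
    lt_of_le_of_lt (Real.exp_le_exp.2 (by linarith)) hNlt
  have hzm : z ≤ max z z' := le_max_left _ _
  have hz'm : z' ≤ max z z' := le_max_right _ _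
  -- window sums at this `N`
  set Φ : ℝ → ℝ := fun y => ∑ n ∈ Finset.range N,
    c n / n * ∫ u in (2 * a - Real.log n)..(y - Real.log n), w u with hΦ
  set F : ℝ := ∑ n ∈ Finset.Icc 1 ⌊Real.exp (4 * a)⌋₊,
    c n / n * ∫ u in (2 * a - Real.log n)..(2 * a), w u with hF
  set H : ℝ → ℝ := fun t => ∑ n ∈ Finset.Icc 1 ⌊Real.exp t⌋₊, c n / n with hH
  -- part 1 in terms of `Φ`, `κ`, `κ₁`
  have hP1' : ∀ y' y : ℝ, 2 * a ≤ y' → y' ≤ y → y ≤ max z z' + 2 * a →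
      |Φ y - Φ y' - (y - y') * κ| ≤ 2 * C * Real.exp (-(y' / 2)) + |κ₁| * Real.exp (-y') := by
    intro y' y hy' hyy hy
    have h := hP1 y' y hy' hyy N (hNy y hy)
    rw [hκ_eq] at h
    simpa only [hΦ] using h
  -- sandwich at `y₁ = z + 2a` (lower) and `y₂ = z' − 2a` (upper)
  have hS1 := (win_sandwich hwc hw hw0 ha c hc (y := z + 2 * a) (by linarith) (hNy' _ (by linarith))).1
  have hS2 := (win_sandwich hwc hw hw0 ha c hc (y := z' - 2 * a) (by linarith) (hNy' _ (by linarith))).2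
  rw [show z + 2 * a - 2 * a = z by ring] at hS1
  rw [show z' - 2 * a + 2 * a = z' by ring] at hS2
  have hdiff : κ * H z - κ * H z' ≤ Φ (z + 2 * a) - Φ (z' - 2 * a) := by
    simp only [hH, hΦ]
    linarith
  -- part 1 between `y₁` and `y₂`, in either order
  have hE1 : 2 * C * Real.exp (-((z' - 2 * a) / 2)) + |κ₁| * Real.exp (-(z' - 2 * a)) < a * κ :=
    hT _ (by linarith)
  have hE2 : 2 * C * Real.exp (-((z + 2 * a) / 2)) + |κ₁| * Real.exp (-(z + 2 * a)) < a * κ :=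
    hT _ (by linarith)
  have hstep : Φ (z + 2 * a) - Φ (z' - 2 * a) ≤ (z - z' + 4 * a) * κ + a * κ := by
    rcases le_or_gt (z' - 2 * a) (z + 2 * a) with h | h
    · have h1 := hP1' (z' - 2 * a) (z + 2 * a) (by linarith) h (by linarith)
      have h2 := (abs_le.1 h1).2
      nlinarith
    · have h1 := hP1' (z + 2 * a) (z' - 2 * a) (by linarith) h.le (by linarith)
      have h2 := (abs_le.1 h1).1
      nlinarith
  -- conclude
  have hfin : κ * (H z - H z') ≤ κ * (z - z' + 5 * a) := by nlinarith
  have hfin' : H z - H z' ≤ z - z' + 5 * a := le_of_mul_le_mul_left hfin hκ_pos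
  simp only [hH] at hfin'
  linarith

/-! ## (ii) Mertens: the limit -/

/-- **Fake PNT ⇒ Mertens**: `Σ_{n ≤ x} c(n)/n − log x` converges as `x → ∞` (the oscillation bound at every
scale `a > 0` makes `H(z) − z` Cauchy; completeness of `ℝ`; `x = e^z`). [folklore] -/
theorem mertens_limit (c : ℕ → ℝ) (hc : ∀ n, 0 ≤ c n)
    (hdisc : ∀ g : ℝ → ℂ, IsWeilTest g → ∃ C : ℝ, ∀ x : ℝ,
      ‖(∑' n : ℕ, ((c n : ℝ) : ℂ) / (Real.sqrt n : ℂ) *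
          (weilConv g (weilReflect g) (x + Real.log n) + weilConv g (weilReflect g) (x - Real.log n))) -
        Complex.exp (x / 2) * weilMellin (weilConv g (weilReflect g)) 0 -
        Complex.exp (-(x / 2)) * weilMellin (weilConv g (weilReflect g)) 1‖ ≤ C) :
    ∃ C : ℝ, Tendsto (fun x : ℝ => (∑ n ∈ Finset.Icc 1 ⌊x⌋₊, c n / n) - Real.log x) atTop (𝓝 C) := by
  set G : ℝ → ℝ := fun z => (∑ n ∈ Finset.Icc 1 ⌊Real.exp z⌋₊, c n / n) - z with hG
  have hGc : CauchySeq G := by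
    refine Metric.cauchySeq_iff.2 fun ε hε => ?_
    have ha : 0 < min 1 (ε / 6) := lt_min one_pos (by linarith)
    obtain ⟨Z, hZ⟩ := mertens_osc_le c hc hdisc ha (min_le_left _ _)
    refine ⟨Z, fun m hm n hn => ?_⟩
    have h1 := hZ m n hm hn
    have h2 := hZ n m hn hm
    have h3 : min 1 (ε / 6) ≤ ε / 6 := min_le_right _ _
    rw [Real.dist_eq, abs_lt]
    simp only [hG]
    constructor <;> linarith
  obtain ⟨C, hC⟩ := cauchySeq_tendsto_of_complete hGc
  refine ⟨C, (hC.comp Real.tendsto_log_atTop).congr' ?_⟩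
  filter_upwards [eventually_gt_atTop 0] with x hx
  simp only [hG, Function.comp_apply, Real.exp_log hx]

/-! ## The stub -/

/-- **Stub M — `fakeMertens` (fake PNT ⇒ Chebyshev and Mertens).**  For `c ≥ 0` with the fake PNT bound of
`stub_fakePNT` (for every Weil test `g`, uniformly in `x`:
`Σ c(n)n^{-1/2}(K(x+log n)+K(x−log n)) = e^{x/2}K̂(0) + e^{-x/2}K̂(1) + O_g(1)`, `K = g⋆g̃`):
(i) Chebyshev `Σ_{n≤x} c(n) ≤ A·x` (`x ≥ 1`); (ii) Mertens `Σ_{n≤x} c(n)/n − log x → C`.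
(i) is the dyadic argument of `stub_chebyshev`; (ii): integrate the discrepancy of a node-nonnegative narrow
bump against `e^{-x/2}` (part 1, `stub_fakeMertens_integrated`), sandwich the sharp harmonic sums between the
resulting window sums (monotonicity, `c ≥ 0`), and let the width `a → 0` (Cauchy criterion). [folklore] -/
theorem stub_fakeMertens :
    ∀ c : ℕ → ℝ, (∀ n, 0 ≤ c n) →
      (∀ g : ℝ → ℂ, IsWeilTest g → ∃ C : ℝ, ∀ x : ℝ,
        ‖(∑' n : ℕ, ((c n : ℝ) : ℂ) / (Real.sqrt n : ℂ) *
            (weilConv g (weilReflect g) (x + Real.log n) + weilConv g (weilReflect g) (x - Real.log n))) -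
          Complex.exp (x / 2) * weilMellin (weilConv g (weilReflect g)) 0 -
          Complex.exp (-(x / 2)) * weilMellin (weilConv g (weilReflect g)) 1‖ ≤ C) →
      ((∃ A : ℝ, ∀ x : ℝ, 1 ≤ x → ∑ n ∈ Finset.Icc 1 ⌊x⌋₊, c n ≤ A * x) ∧
        (∃ C : ℝ, Filter.Tendsto (fun x : ℝ => (∑ n ∈ Finset.Icc 1 ⌊x⌋₊, c n / n) - Real.log x)
          Filter.atTop (nhds C))) :=
  fun c hc hdisc => ⟨chebyshev_linear c hc hdisc, mertens_limit c hc hdisc⟩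

end Summit.RiemannHypothesis.RiemannHypothesis.Theorems.SignConeConeMagnification

end
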